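import Summits.QuantumFields.YangMills.Theorems.SoloBlindOddTorusSlabRP
import Summits.QuantumFields.YangMills.Theorems.SoloBlindLatticeGapAntipodal
import HarnessLib

/-!
# Species in time slabs and the dictionary to the OS pairings
# (solo-QuantumFields-blind, rung D8, part 10)

`Summit.QuantumFields.YangMills.Theorems.SoloBlindSpeciesSlab` (read-only conjunct `YangMills`).
Bookkeeping for the general-species form of the lattice-gap reduction (part 11,
`SoloBlindLatticeGapReflected`).  Write `Θ A := A.timeReflect` (tree, `SpeciesTimeReflection`),
`Â_c` for the centred torus observable of `A` on the odd torus `(ℤ/(2S+1))⁴`, `Θ'` for the site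
time reflection of torus configurations and `P_{F,G}(n) = ⟨(F∘Θ') · G(· + n e₀)⟩` for the OS
pairing of part 8 (`osPairingSeq`).

* `IsSlabSupported T' T A` — the support of `A` lies in the time slab `[-T', T]`; every species
  is slab-supported (`exists_isSlabSupported`, finite support);
* `dependsOn_toTorusObservable_slab`, `dependsOn_toTorusObservable_negReflect_slab` — on the odd
  torus `2S + 1 > T, T'` the observables `Â - c` and `Â∘Θ' - c` are slab observables in the
  sense of part 8 (`slabEdges T' T`, resp. `slabEdges T T'`);
* dictionaries: `c_{A,B}(n) = P_{Â_c∘Θ', B̂_c}(n)` (`latticeConnectedCorr_eq_osPairingSeq`),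
  `P_{B̂_c,B̂_c}(n) = c_{ΘB,B}(n)`, `P_{Â_c∘Θ',Â_c∘Θ'}(n) = c_{A,ΘA}(n)`, and, going round the
  torus, `P_{B̂_c,B̂_c}(S+1) = c_{B,ΘB}(S)`, `P_{Â_c∘Θ',Â_c∘Θ'}(S+1) = c_{ΘA,A}(S)`
  (`c_{A,B}(n) := latticeConnectedCorr ρ β (2S+1) A B n`, the statement's correlator).

[folklore: periodic boundary conditions and site reflection, Seiler LNP 159 Ch. 2;
Osterwalder–Seiler 1978 §2]
-/

open MeasureTheory
open Literature.MathematicalPhysics.QuantumFieldTheory Literature.MathematicalPhysics.QuantumLattice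

noncomputable section

namespace Summit.QuantumFields.YangMills.Theorems.SoloBlind

variable {G : Type} [Group G] [TopologicalSpace G] [IsTopologicalGroup G] [CompactSpace G]
  [MeasurableSpace G] [BorelSpace G]

/-! ### Time slabs of species and of their torus observables -/

/-- A species is **supported in the time slab `[-T', T]`**: every link of its support starts at a
time in `[-T', T]`, temporal links moreover END by time `T`. [this unit's bookkeeping] -/
def IsSlabSupported (T' T : ℕ) (A : YMSpecies G) : Prop :=
  ∀ e ∈ A.supp, -(T' : ℤ) ≤ e.1 0 ∧ e.1 0 + (if e.2 = 0 then 1 else 0) ≤ (T : ℤ)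

omit [TopologicalSpace G] [IsTopologicalGroup G] [CompactSpace G] [BorelSpace G] in
/-- Every species is slab-supported (its support is finite). -/
theorem exists_isSlabSupported (A : YMSpecies G) : ∃ T' T : ℕ, IsSlabSupported T' T A := by
  refine ⟨A.supp.sup (fun e => (e.1 0).natAbs), A.supp.sup (fun e => (e.1 0).natAbs) + 1,
    fun e he => ?_⟩
  have h : (e.1 0).natAbs ≤ A.supp.sup (fun e => (e.1 0).natAbs) :=
    Finset.le_sup (f := fun e : Literature.MathematicalPhysics.QuantumLattice.ZdEdge 4 => (e.1 0).natAbs) he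
  have h1 := Int.le_natAbs (a := e.1 0)
  have h2 : -((e.1 0).natAbs : ℤ) ≤ e.1 0 := by
    have := Int.le_natAbs (a := -(e.1 0)); rw [Int.natAbs_neg] at this; omega
  constructor
  · omega
  · split_ifs <;> push_cast <;> omega

/-- Time value, on the odd torus `2S + 1 > T, T'`, of the projection of a `ℤ⁴` link with time in
`[-T', T]`: it lies in the torus slab `slabEdges T' T`. -/
private theorem torusEdge_mem_slabEdges {T' T S : ℕ} (hT : T < 2 * S + 1) (hT' : T' < 2 * S + 1)
    {e : Literature.MathematicalPhysics.QuantumLattice.ZdEdge 4} (he0 : -(T' : ℤ) ≤ e.1 0)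
    (heT : e.1 0 + (if e.2 = 0 then 1 else 0) ≤ (T : ℤ)) :
    torusEdge (2 * S + 1) e ∈ (slabEdges T' T : Set (Edge 4 (2 * S + 1))) := by
  simp only [slabEdges, Set.mem_setOf_eq]
  have h2 : (torusEdge (2 * S + 1) e).2 = e.2 := rfl
  rw [h2]
  rcases le_or_gt 0 (e.1 0) with hpos | hneg
  · obtain ⟨t, ht⟩ := Int.eq_ofNat_of_zero_le hpos
    have hval : ((torusEdge (2 * S + 1) e).1 0).val = t := by
      simp only [torusEdge, Literature.Probability.LatticeModels.Torus.proj_apply, ht,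
        Int.cast_natCast, ZMod.val_natCast]
      exact Nat.mod_eq_of_lt (by split_ifs at heT <;> omega)
    rw [hval]
    left
    split_ifs at heT ⊢ <;> omega
  · obtain ⟨u, hu⟩ := Int.exists_eq_neg_ofNat hneg.le
    have huL : u < 2 * S + 1 := by omega
    have hvu : ((u : ℕ) : ZMod (2 * S + 1)).val = u := by
      rw [ZMod.val_natCast, Nat.mod_eq_of_lt huL]
    have hne : ((u : ℕ) : ZMod (2 * S + 1)) ≠ 0 := by
      intro h0
      rw [h0, ZMod.val_zero] at hvu
      omega
    have hval : ((torusEdge (2 * S + 1) e).1 0).val = 2 * S + 1 - u := by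
      simp only [torusEdge, Literature.Probability.LatticeModels.Torus.proj_apply, hu,
        Int.cast_neg, Int.cast_natCast, ZMod.neg_val, if_neg hne, hvu]
    rw [hval]
    right
    omega

/-- The same for the SITE-REFLECTED torus link: it lies in the reflected slab `slabEdges T T'`. -/
private theorem siteEdgeReflect_torusEdge_mem_slabEdges {T' T S : ℕ} (hT : T < 2 * S + 1)
    (hT' : T' < 2 * S + 1) (hS : 1 ≤ S) {e : Literature.MathematicalPhysics.QuantumLattice.ZdEdge 4} (he0 : -(T' : ℤ) ≤ e.1 0)
    (heT : e.1 0 + (if e.2 = 0 then 1 else 0) ≤ (T : ℤ)) :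
    WilsonSiteRP.siteEdgeReflect (torusEdge (2 * S + 1) e) ∈
      (slabEdges T T' : Set (Edge 4 (2 * S + 1))) := by
  haveI : Fact (1 < 2 * S + 1) := ⟨by omega⟩
  have h2 : (torusEdge (2 * S + 1) e).2 = e.2 := rfl
  -- the time value `v` of the projected base point
  obtain ⟨v, hv, hcase⟩ : ∃ v : ℕ, ((torusEdge (2 * S + 1) e).1 0).val = v ∧
      ((e.1 0 = v ∧ v + (if e.2 = 0 then 1 else 0) ≤ T) ∨
        (∃ u : ℕ, 1 ≤ u ∧ u ≤ T' ∧ v = 2 * S + 1 - u)) := by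
    rcases le_or_gt 0 (e.1 0) with hpos | hneg
    · obtain ⟨t, ht⟩ := Int.eq_ofNat_of_zero_le hpos
      refine ⟨t, ?_, Or.inl ⟨ht, by split_ifs at heT ⊢ <;> omega⟩⟩
      simp only [torusEdge, Literature.Probability.LatticeModels.Torus.proj_apply, ht,
        Int.cast_natCast, ZMod.val_natCast]
      exact Nat.mod_eq_of_lt (by split_ifs at heT <;> omega)
    · obtain ⟨u, hu⟩ := Int.exists_eq_neg_ofNat hneg.le
      have huL : u < 2 * S + 1 := by omega
      have hvu : ((u : ℕ) : ZMod (2 * S + 1)).val = u := by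
        rw [ZMod.val_natCast, Nat.mod_eq_of_lt huL]
      have hne : ((u : ℕ) : ZMod (2 * S + 1)) ≠ 0 := by
        intro h0
        rw [h0, ZMod.val_zero] at hvu
        omega
      refine ⟨2 * S + 1 - u, ?_, Or.inr ⟨u, by omega, by omega, rfl⟩⟩
      simp only [torusEdge, Literature.Probability.LatticeModels.Torus.proj_apply, hu,
        Int.cast_neg, Int.cast_natCast, ZMod.neg_val, if_neg hne, hvu]
  simp only [slabEdges, Set.mem_setOf_eq, WilsonSiteRP.siteEdgeReflect, h2]
  by_cases he2 : e.2 = 0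
  · simp only [he2, ↓reduceIte, WilsonSiteRP.val_negReflect_shift_zero, hv]
    rw [if_pos he2] at hcase
    rcases hcase with ⟨-, hvT⟩ | ⟨u, hu1, hu2, hvu⟩
    · right
      rw [if_neg (by omega)]
      omega
    · left
      split_ifs <;> omega
  · simp only [he2, ↓reduceIte, WilsonSiteRP.val_negReflect, hv, add_zero]
    rw [if_neg he2] at hcase
    rcases hcase with ⟨-, hvT⟩ | ⟨u, hu1, hu2, hvu⟩
    · by_cases hv0 : v = 0
      · left; rw [if_pos hv0]; exact Nat.zero_le _
      · right; rw [if_neg hv0]; omega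
    · left
      split_ifs <;> omega

omit [TopologicalSpace G] [IsTopologicalGroup G] [CompactSpace G] [BorelSpace G] in
/-- The (shifted) torus observable of a `[-T', T]`-slab species is a `[-T', T]`-slab observable
of the odd torus `2S + 1 > T, T'`. -/
theorem dependsOn_toTorusObservable_slab {T' T S : ℕ} (hT : T < 2 * S + 1) (hT' : T' < 2 * S + 1)
    (A : YMSpecies G) (hA : IsSlabSupported T' T A) (c : ℝ) :
    DependsOn (fun U : GaugeConfig 4 (2 * S + 1) G => toTorusObservable (2 * S + 1) A.F U - c)
      (slabEdges T' T) := by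
  intro U V hUV
  simp only [toTorusObservable_apply, sub_left_inj]
  apply A.isCylinder
  intro e he
  obtain ⟨he0, heT⟩ := hA e (Finset.mem_coe.mp he)
  simp only [torusLift, Function.comp_apply]
  exact hUV _ (torusEdge_mem_slabEdges hT hT' he0 heT)

omit [TopologicalSpace G] [IsTopologicalGroup G] [CompactSpace G] [BorelSpace G] in
/-- The REFLECTED torus observable `U ↦ Â(Θ'U) - c` of a `[-T', T]`-slab species is a
`[-T, T']`-slab observable of the odd torus `2S + 1 > T, T'`, `S ≥ 1`. -/
theorem dependsOn_toTorusObservable_negReflect_slab {T' T S : ℕ} (hT : T < 2 * S + 1)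
    (hT' : T' < 2 * S + 1) (hS : 1 ≤ S) (A : YMSpecies G) (hA : IsSlabSupported T' T A)
    (c : ℝ) :
    DependsOn (fun U : GaugeConfig 4 (2 * S + 1) G =>
      toTorusObservable (2 * S + 1) A.F U.negReflect - c) (slabEdges T T') := by
  intro U V hUV
  simp only [toTorusObservable_apply, sub_left_inj]
  apply A.isCylinder
  intro e he
  obtain ⟨he0, heT⟩ := hA e (Finset.mem_coe.mp he)
  have hmem := siteEdgeReflect_torusEdge_mem_slabEdges hT hT' hS he0 heT
  simp only [torusLift, Function.comp_apply, WilsonSiteRP.negReflect_apply]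
  rw [hUV _ hmem]

omit [CompactSpace G] in
/-- The torus observable of the reflected species `ΘA` is the torus observable of `A` read on the
site-reflected configuration (tree: `torusLift_negReflect`). -/
theorem toTorusObservable_timeReflect (L : ℕ) (A : YMSpecies G) :
    toTorusObservable L A.timeReflect.F =
      fun U : GaugeConfig 4 L G => toTorusObservable L A.F U.negReflect := by
  funext U
  simp [toTorusObservable_apply, torusLift_negReflect]

/-- The centred torus observable of `ΘA` is the reflected centred torus observable of `A`
(`Θ'`-invariance of Wilson's measure). -/
theorem centred_toTorusObservable_timeReflect {N : ℕ} (ρ : G →* Matrix (Fin N) (Fin N) ℂ)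
    (hρ : Continuous ρ) (β : ℝ) (L : ℕ) [NeZero L] (A : YMSpecies G) :
    (fun U : GaugeConfig 4 L G => toTorusObservable L A.timeReflect.F U -
        wilsonExpectation ρ β (toTorusObservable L A.timeReflect.F)) =
      fun U => toTorusObservable L A.F U.negReflect -
        wilsonExpectation ρ β (toTorusObservable L A.F) := by
  have hE : wilsonExpectation ρ β (toTorusObservable L A.timeReflect.F) =
      wilsonExpectation ρ β (toTorusObservable L A.F) := by
    rw [toTorusObservable_timeReflect]
    exact integral_comp_negReflect_eq ρ hρ β _
  funext U
  rw [hE, toTorusObservable_timeReflect]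

/-! ### Dictionaries between the statement's correlator and the OS pairings -/

section Dict

variable {N : ℕ} (ρ : G →* Matrix (Fin N) (Fin N) ℂ) (hρ : Continuous ρ) (β : ℝ) (S : ℕ)

include hρ in
/-- `c_{A,B}(n) = P_{Â_c ∘ Θ', B̂_c}(n)` (pair dictionary of part 6 and `Θ'² = 1`). -/
theorem latticeConnectedCorr_eq_osPairingSeq (A B : YMSpecies G) (n : ℕ) :
    latticeConnectedCorr ρ β (2 * S + 1) A.F B.F n =
      osPairingSeq ρ β
        (fun U => toTorusObservable (2 * S + 1) A.F U.negReflect -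
          wilsonExpectation ρ β (toTorusObservable (2 * S + 1) A.F))
        (fun U => toTorusObservable (2 * S + 1) B.F U -
          wilsonExpectation ρ β (toTorusObservable (2 * S + 1) B.F)) n := by
  rw [latticeConnectedCorr_eq_timeTwoPtMixedSeq ρ hρ]
  unfold osPairingSeq osPairing timeTwoPtMixedSeq
  simp only [WilsonSiteRP.negReflect_negReflect_config]

include hρ in
/-- `P_{B̂_c, B̂_c}(n) = c_{ΘB,B}(n)`. -/
theorem osPairingSeq_centred_eq (B : YMSpecies G) (n : ℕ) :
    osPairingSeq ρ β
        (fun U => toTorusObservable (2 * S + 1) B.F U -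
          wilsonExpectation ρ β (toTorusObservable (2 * S + 1) B.F))
        (fun U => toTorusObservable (2 * S + 1) B.F U -
          wilsonExpectation ρ β (toTorusObservable (2 * S + 1) B.F)) n =
      latticeConnectedCorr ρ β (2 * S + 1) B.timeReflect.F B.F n := by
  rw [latticeConnectedCorr_eq_timeTwoPtMixedSeq ρ hρ, centred_toTorusObservable_timeReflect ρ hρ]
  rfl

include hρ in
/-- `P_{Â_c∘Θ', Â_c∘Θ'}(n) = c_{A,ΘA}(n)`. -/
theorem osPairingSeq_centred_negReflect_eq (A : YMSpecies G) (n : ℕ) :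
    osPairingSeq ρ β
        (fun U => toTorusObservable (2 * S + 1) A.F U.negReflect -
          wilsonExpectation ρ β (toTorusObservable (2 * S + 1) A.F))
        (fun U => toTorusObservable (2 * S + 1) A.F U.negReflect -
          wilsonExpectation ρ β (toTorusObservable (2 * S + 1) A.F)) n =
      latticeConnectedCorr ρ β (2 * S + 1) A.F A.timeReflect.F n := by
  rw [latticeConnectedCorr_eq_timeTwoPtMixedSeq ρ hρ, centred_toTorusObservable_timeReflect ρ hρ]
  unfold osPairingSeq osPairing timeTwoPtMixedSeq
  simp only [WilsonSiteRP.negReflect_negReflect_config]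

/-- **Going round the torus**: `P_{F,F}(S + 1) = M_{F, F∘Θ'}(S)` on the torus `2S + 1`
(`S + 1 ≡ -S` and the swap `M_{X,Y}(-s) = M_{Y,X}(s)`; no symmetry of `F` needed). [folklore] -/
theorem osPairingSeq_antipode_succ (F : GaugeConfig 4 (2 * S + 1) G → ℝ) :
    osPairingSeq ρ β F F (S + 1) = timeTwoPtMixedSeq ρ β F (fun U => F U.negReflect) S := by
  unfold osPairingSeq osPairing timeTwoPtMixedSeq
  rw [timeTwoPtMixed_swap]
  congr 1
  have h : ((2 * S + 1 : ℕ) : ZMod (2 * S + 1)) = 0 := ZMod.natCast_self _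
  have h' : ((S + 1 : ℕ) : ZMod (2 * S + 1)) + ((S : ℕ) : ZMod (2 * S + 1)) =
      ((2 * S + 1 : ℕ) : ZMod (2 * S + 1)) := by
    push_cast; ring
  rw [h] at h'
  exact neg_eq_of_add_eq_zero_right h'

include hρ in
/-- `P_{B̂_c,B̂_c}(S + 1) = c_{B,ΘB}(S)`. -/
theorem osPairingSeq_centred_succ_eq (B : YMSpecies G) :
    osPairingSeq ρ β
        (fun U => toTorusObservable (2 * S + 1) B.F U -
          wilsonExpectation ρ β (toTorusObservable (2 * S + 1) B.F))
        (fun U => toTorusObservable (2 * S + 1) B.F U -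
          wilsonExpectation ρ β (toTorusObservable (2 * S + 1) B.F)) (S + 1) =
      latticeConnectedCorr ρ β (2 * S + 1) B.F B.timeReflect.F S := by
  rw [osPairingSeq_antipode_succ, latticeConnectedCorr_eq_timeTwoPtMixedSeq ρ hρ,
    centred_toTorusObservable_timeReflect ρ hρ]

include hρ in
/-- `P_{Â_c∘Θ',Â_c∘Θ'}(S + 1) = c_{ΘA,A}(S)`. -/
theorem osPairingSeq_centred_negReflect_succ_eq (A : YMSpecies G) :
    osPairingSeq ρ β
        (fun U => toTorusObservable (2 * S + 1) A.F U.negReflect -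
          wilsonExpectation ρ β (toTorusObservable (2 * S + 1) A.F))
        (fun U => toTorusObservable (2 * S + 1) A.F U.negReflect -
          wilsonExpectation ρ β (toTorusObservable (2 * S + 1) A.F)) (S + 1) =
      latticeConnectedCorr ρ β (2 * S + 1) A.timeReflect.F A.F S := by
  rw [osPairingSeq_antipode_succ, latticeConnectedCorr_eq_timeTwoPtMixedSeq ρ hρ,
    centred_toTorusObservable_timeReflect ρ hρ]
  unfold timeTwoPtMixedSeq
  simp only [WilsonSiteRP.negReflect_negReflect_config]

end Dict

end Summit.QuantumFields.YangMills.Theorems.SoloBlind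

end
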